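import Literature.Barriers.CriticalPhenomena.PlanarEdwardsModelDiffusivePairKernelCovariance
import Literature.Barriers.CriticalPhenomena.PlanarEdwardsModelDiffusiveSRWLocalCLT
import Mathlib.Analysis.SpecialFunctions.Integrals.Basic
import Mathlib.NumberTheory.Harmonic.Bounds
import HarnessLib

/-!
# Bounds on the pair covariance kernel of the planar simple random walk

Sibling proof file of `…PlanarEdwardsModelDiffusivePairKernel` / `…PairKernelCovariance`
(objects `prob`, `pairJoint`, `pairKernel`, `pairKernelAt`) and `…SRWLocalCLT` (the Fourier
representation of the `±1` walk and the 45° rotation). PROVED here, all elementary: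

* parity: `pairKernel A B C = 0` unless `A ≡ B ≡ C (mod 2)` (`pairKernel_eq_zero_of_odd_left/right`);
* spatial smoothness of the point probabilities (Fourier form on the half period,
  `1 - cos(uθ) ≤ u²θ²/2`, Jordan's inequality and Wallis' recursion):
  `p_A(y) ≤ p_{2⌊A/2⌋}(0)` and `p_A(y) ≥ p_{2⌈A/2⌉}(0)(1 - (π²/4)|y|²/(A+2))` on the parity class
  of `A` (`prob_le_prob_two_mul_div_two`, `prob_ge_prob_mul_one_sub`);
* increments of the return probabilities: `0 ≤ p_{2q}(0) - p_{2(q+s)}(0) ≤ 1/(q+½) - 1/(q+s+½)`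
  (`prob_two_mul_zero_sub_le`, central binomial recursion);
* the conditioning bounds `j(A,B,C) ≤ p_{A+B}(0)/(C+1)`, `≤ p_{B+C}(0)/(A+1)` and the crude bound
  `|K(A,B,C)| ≤ 2/((A+1)(B+C+1))`;
* the conditioning identity `K(A,B,C) = 𝔼_β[p_C(Y_B)(p_A(Y_B) - p_{A+B}(0))]` and the refined bound
  `|K(A,B,C)| ≤ 16/((A+1)(A+B+C+1))` when `1 ≤ B ≤ A`, `C ≤ A` (`abs_pairKernel_le_of_max_left`);
* **the universal bound** `|K(A,B,C)| ≤ 16/((max(A,C)+1)(A+B+C+1))` (`abs_pairKernel_le`), its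
  form at the overlap data of two time pairs
  `|pairKernelAt r i j k l| ≤ 32/((|i₁-k₁| + |j₁-l₁| + 1)(max - min + 1))`
  (`abs_pairKernelAt_le_strong`, `…_le_prod`), and the **slab sums**
  `Σ_{j,k,l<M} |pairKernelAt r i₀ j k l| ≤ 256 M (1 + log M)²` (`slab_sum_abs_pairKernelAt_le(')`).

These are the domination / boundary inputs of the limit of `coreSum r M / M²` (the second-moment
limits (α₁), (α₂) behind `Edwards2D.Stoll1989_invariance_of_secondMomentLimits`).

## References

* A. Stoll, Math. Scand. 64 (1989), 133–160, §1, Proposition 1.10 (moment bounds for the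
  intersection local time of the lattice walk). [Stoll1989]
* G. F. Lawler, *Intersections of Random Walks* (1991), Theorem 1.2.1 and Proposition 6.4.1.
  [Lawler1991]
-/

noncomputable section

open Finset Real MeasureTheory intervalIntegral
open scoped BigOperators

namespace Literature.Barriers.CriticalPhenomena

namespace Edwards2D

open Literature.Probability.LatticeModels Literature.Probability.Percolation
open Literature.Probability.RandomPlanarGeometry.SAW.Zd (normSq)

variable {m n : ℕ}

/-! ### Parity -/

/-- The coordinate sum of the endpoint of a `B`-step walk has the parity of `B`. [folklore] -/
theorem even_add_endpoint_sum (β : StepSeq m) : Even ((m : ℤ) + (endpoint β 0 + endpoint β 1)) := by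
  have h1 : endpoint β 0 + endpoint β 1 = ∑ i : Fin m, (stepVec (β i) 0 + stepVec (β i) 1) := by
    simp [endpoint, Finset.sum_apply, Finset.sum_add_distrib]
  have h2 : ∀ c : Fin 4, Even ((1 : ℤ) + (stepVec c 0 + stepVec c 1)) := by
    intro c; fin_cases c <;> decide
  have h3 : Even (∑ i : Fin m, ((1 : ℤ) + (stepVec (β i) 0 + stepVec (β i) 1))) :=
    Finset.even_sum _ fun i _ => h2 (β i)
  rw [Finset.sum_add_distrib] at h3
  simpa [h1] using h3

/-- Parity of the point probabilities: `p_m(y) = 0` unless `y₀ + y₁ ≡ m (mod 2)`. [folklore] -/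
theorem prob_eq_zero_of_odd {y : Site 2} (h : ¬ Even ((m : ℤ) + (y 0 + y 1))) : prob m y = 0 :=
  expect_ite_endpoint_eq_eq_zero_of_odd h

/-- `p_m(0) = 0` for odd `m`. [folklore] -/
theorem prob_zero_eq_zero_of_odd (h : ¬ Even m) : prob m 0 = 0 := by
  refine prob_eq_zero_of_odd ?_
  simpa [Int.even_coe_nat] using h

/-- The kernel vanishes unless `A + B` is even. [folklore] -/
theorem pairKernel_eq_zero_of_odd_left {A B C : ℕ} (h : ¬ Even (A + B)) : pairKernel A B C = 0 := by
  have hp : prob (A + B) 0 = 0 := prob_zero_eq_zero_of_odd h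
  have hj : pairJoint A B C = 0 :=
    le_antisymm ((pairJoint_le_prob_left A B C).trans hp.le) (pairJoint_nonneg A B C)
  unfold pairKernel; rw [hj, hp, zero_mul, sub_zero]

/-- The kernel vanishes unless `B + C` is even. [folklore] -/
theorem pairKernel_eq_zero_of_odd_right {A B C : ℕ} (h : ¬ Even (B + C)) : pairKernel A B C = 0 := by
  rw [pairKernel_comm]
  exact pairKernel_eq_zero_of_odd_left (by rwa [add_comm])

/-! ### The `±1` walk: the point probabilities are nearly constant on the scale `√A` -/

/-- `0 ≤ cos^A θ` on `[-π/2, π/2]`. [folklore] -/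
theorem cos_pow_nonneg_of_mem {θ : ℝ} (hθ : θ ∈ Set.Icc (-(π / 2)) (π / 2)) (A : ℕ) : 0 ≤ Real.cos θ ^ A :=
  pow_nonneg (Real.cos_nonneg_of_mem_Icc hθ) A

/-- **Wallis' recursion on the half period**: `∫_{-π/2}^{π/2} cos^{A+2} = ((A+1)/(A+2)) ∫_{-π/2}^{π/2} cos^A`.
[folklore] -/
theorem integral_cos_pow_succ_succ_half (A : ℕ) :
    ∫ θ in (-(π / 2))..(π / 2), Real.cos θ ^ (A + 2) =
      ((A : ℝ) + 1) / (A + 2) * ∫ θ in (-(π / 2))..(π / 2), Real.cos θ ^ A := by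
  rw [integral_cos_pow]
  simp [Real.cos_pi_div_two]

/-- `∫_{-π/2}^{π/2} cos^A > 0`. [folklore] -/
theorem integral_cos_pow_half_pos (A : ℕ) : 0 < ∫ θ in (-(π / 2))..(π / 2), Real.cos θ ^ A := by
  refine intervalIntegral.intervalIntegral_pos_of_pos_on ((Real.continuous_cos.pow A).intervalIntegrable _ _)
    (fun θ hθ => pow_pos (Real.cos_pos_of_mem_Ioo hθ) A) (by linarith [Real.pi_pos])

/-- `∫_{-π/2}^{π/2} cos^{A+1} ≤ ∫_{-π/2}^{π/2} cos^A`. [folklore] -/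
theorem integral_cos_pow_succ_half_le (A : ℕ) :
    ∫ θ in (-(π / 2))..(π / 2), Real.cos θ ^ (A + 1) ≤ ∫ θ in (-(π / 2))..(π / 2), Real.cos θ ^ A := by
  refine intervalIntegral.integral_mono_on (by linarith [Real.pi_pos])
    ((Real.continuous_cos.pow _).intervalIntegrable _ _) ((Real.continuous_cos.pow _).intervalIntegrable _ _)
    fun θ hθ => ?_
  rw [pow_succ]
  exact mul_le_of_le_one_right (cos_pow_nonneg_of_mem hθ A) (Real.cos_le_one θ)

/-- `∫_{-π/2}^{π/2} cos^{A+s} ≤ ∫_{-π/2}^{π/2} cos^A`. [folklore] -/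
theorem integral_cos_pow_add_half_le (A s : ℕ) :
    ∫ θ in (-(π / 2))..(π / 2), Real.cos θ ^ (A + s) ≤ ∫ θ in (-(π / 2))..(π / 2), Real.cos θ ^ A := by
  induction s with
  | zero => simp
  | succ s ih => exact (integral_cos_pow_succ_half_le (A + s)).trans ih

/-- **Upper bound by the value at the parity-origin**: for `A + u` even,
`P[S_A = u] ≤ π⁻¹ ∫_{-π/2}^{π/2} cos^A` (`|cos(uθ)| ≤ 1`, `cos^A ≥ 0` on the half period).
[cite: Lawler1991, §1.2 (proof of Theorem 1.2.1)] -/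
theorem expect_ite_signSum_le_integral {A : ℕ} {u : ℤ} (h : Even ((A : ℤ) + u)) :
    𝔼 ε : Fin A → Bool, (if (∑ i, if ε i then (1 : ℤ) else -1) = u then (1 : ℝ) else 0) ≤
      π⁻¹ * ∫ θ in (-(π / 2))..(π / 2), Real.cos θ ^ A := by
  rw [expect_ite_signSum_eq_eq_integral_half h]
  refine mul_le_mul_of_nonneg_left ?_ (inv_pos.2 Real.pi_pos).le
  refine intervalIntegral.integral_mono_on (by linarith [Real.pi_pos])
    (((Real.continuous_cos.pow A).mul (Real.continuous_cos.comp
      (continuous_const.mul continuous_id))).intervalIntegrable _ _)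
    ((Real.continuous_cos.pow A).intervalIntegrable _ _) fun θ hθ => ?_
  exact mul_le_of_le_one_right (cos_pow_nonneg_of_mem hθ A) (Real.cos_le_one _)

/-- **Smoothness in space**: for `A + u` even,
`π⁻¹ ∫ cos^A - P[S_A = u] ≤ (π²/8) u²/(A+2) · π⁻¹ ∫ cos^A` (`1 - cos(uθ) ≤ u²θ²/2`,
Jordan's `θ² ≤ (π²/4) sin² θ`, and Wallis' `∫ sin² cos^A = ∫ cos^A/(A+2)` on the half period).
[cite: Lawler1991, §1.2 (proof of Theorem 1.2.1)] -/
theorem integral_sub_expect_ite_signSum_le {A : ℕ} {u : ℤ} (h : Even ((A : ℤ) + u)) :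
    π⁻¹ * (∫ θ in (-(π / 2))..(π / 2), Real.cos θ ^ A) -
        𝔼 ε : Fin A → Bool, (if (∑ i, if ε i then (1 : ℤ) else -1) = u then (1 : ℝ) else 0) ≤
      (π ^ 2 / 8) * (u : ℝ) ^ 2 / (A + 2) * (π⁻¹ * ∫ θ in (-(π / 2))..(π / 2), Real.cos θ ^ A) := by
  rw [expect_ite_signSum_eq_eq_integral_half h]
  have hint : ∀ k : ℕ, IntervalIntegrable (fun θ => Real.cos θ ^ k) volume (-(π / 2)) (π / 2) :=
    fun k => (Real.continuous_cos.pow k).intervalIntegrable _ _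
  have hint2 : IntervalIntegrable (fun θ => Real.cos θ ^ A * Real.cos (u * θ)) volume (-(π / 2)) (π / 2) :=
    ((Real.continuous_cos.pow A).mul (Real.continuous_cos.comp
      (continuous_const.mul continuous_id))).intervalIntegrable _ _
  -- `∫ cos^A (1 - cos(uθ)) ≤ (u²/2)(π²/4) ∫ cos^A sin² = (u²/2)(π²/4) ∫ cos^A /(A+2)`
  have hsin : ∫ θ in (-(π / 2))..(π / 2), Real.cos θ ^ A * Real.sin θ ^ 2 =
      (1 / ((A : ℝ) + 2)) * ∫ θ in (-(π / 2))..(π / 2), Real.cos θ ^ A := by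
    have h1 : ∀ θ : ℝ, Real.cos θ ^ A * Real.sin θ ^ 2 = Real.cos θ ^ A - Real.cos θ ^ (A + 2) := by
      intro θ; rw [Real.sin_sq]; ring
    simp_rw [h1]
    rw [intervalIntegral.integral_sub (hint A) (hint (A + 2)), integral_cos_pow_succ_succ_half]
    have : (A : ℝ) + 2 ≠ 0 := by positivity
    field_simp
    ring
  have hkey : (∫ θ in (-(π / 2))..(π / 2), Real.cos θ ^ A) -
      (∫ θ in (-(π / 2))..(π / 2), Real.cos θ ^ A * Real.cos (u * θ)) ≤
      ((u : ℝ) ^ 2 / 2) * (π ^ 2 / 4) * ∫ θ in (-(π / 2))..(π / 2), Real.cos θ ^ A * Real.sin θ ^ 2 := by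
    rw [← intervalIntegral.integral_sub (hint A) hint2, ← intervalIntegral.integral_const_mul]
    refine intervalIntegral.integral_mono_on (by linarith [Real.pi_pos]) ((hint A).sub hint2)
      (((hint A).mul_continuousOn (by fun_prop)).const_mul _) fun θ hθ => ?_
    have hc : 0 ≤ Real.cos θ ^ A := cos_pow_nonneg_of_mem hθ A
    -- `1 - cos(uθ) ≤ (uθ)²/2` and `θ² ≤ (π²/4) sin² θ`
    have h1 : 1 - Real.cos (u * θ) ≤ ((u : ℝ) * θ) ^ 2 / 2 := by
      linarith [Real.one_sub_sq_div_two_le_cos (x := (u : ℝ) * θ)]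
    have h2 : θ ^ 2 ≤ (π ^ 2 / 4) * Real.sin θ ^ 2 := by
      have hj : 2 / π * |θ| ≤ Real.sin |θ| :=
        Real.mul_le_sin (abs_nonneg θ) (abs_le.2 ⟨by linarith [hθ.1], hθ.2⟩)
      have h3 : (2 / π * |θ|) ^ 2 ≤ Real.sin |θ| ^ 2 :=
        pow_le_pow_left₀ (by positivity) hj 2
      have hs : Real.sin |θ| ^ 2 = Real.sin θ ^ 2 := by
        rcases abs_choice θ with h' | h' <;> simp [h', Real.sin_neg]
      rw [hs, mul_pow, sq_abs, div_pow] at h3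
      have hπ : 0 < π ^ 2 := by positivity
      calc θ ^ 2 = (π ^ 2 / 4) * ((2 : ℝ) ^ 2 / π ^ 2 * θ ^ 2) := by field_simp; ring
        _ ≤ (π ^ 2 / 4) * Real.sin θ ^ 2 := by gcongr
    calc Real.cos θ ^ A - Real.cos θ ^ A * Real.cos (u * θ) = Real.cos θ ^ A * (1 - Real.cos (u * θ)) := by ring
      _ ≤ Real.cos θ ^ A * (((u : ℝ) * θ) ^ 2 / 2) := by gcongr
      _ = ((u : ℝ) ^ 2 / 2) * (Real.cos θ ^ A * θ ^ 2) := by ring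
      _ ≤ ((u : ℝ) ^ 2 / 2) * (Real.cos θ ^ A * ((π ^ 2 / 4) * Real.sin θ ^ 2)) := by gcongr
      _ = (u : ℝ) ^ 2 / 2 * (π ^ 2 / 4) * (Real.cos θ ^ A * Real.sin θ ^ 2) := by ring
  rw [hsin] at hkey
  rw [← mul_sub]
  have hπ : 0 < π⁻¹ := inv_pos.2 Real.pi_pos
  calc π⁻¹ * ((∫ θ in (-(π / 2))..(π / 2), Real.cos θ ^ A) -
        ∫ θ in (-(π / 2))..(π / 2), Real.cos θ ^ A * Real.cos (u * θ))
      ≤ π⁻¹ * (((u : ℝ) ^ 2 / 2) * (π ^ 2 / 4) *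
          ((1 / ((A : ℝ) + 2)) * ∫ θ in (-(π / 2))..(π / 2), Real.cos θ ^ A)) :=
        mul_le_mul_of_nonneg_left hkey hπ.le
    _ = _ := by ring

/-! ### The planar point probabilities: upper and lower comparison with return probabilities -/

/-- `p_{2q}(0) = (π⁻¹ ∫_{-π/2}^{π/2} cos^{2q})²`. [cite: Lawler1991, §1.2] -/
theorem prob_two_mul_zero_eq_sq_integral (q : ℕ) :
    prob (2 * q) 0 = (π⁻¹ * ∫ θ in (-(π / 2))..(π / 2), Real.cos θ ^ (2 * q)) ^ 2 := by
  rw [prob_eq, expect_ite_endpoint_eq_zero_eq_sq]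
  have h : Even (((2 * q : ℕ) : ℤ) + 0) := by simp
  rw [expect_ite_signSum_eq_eq_integral_half h]
  simp

/-- **Upper comparison**: for `y₀ + y₁ ≡ A (mod 2)`, `p_A(y) ≤ p_{2⌊A/2⌋}(0)`.
[cite: Lawler1991, §1.2 (proof of Theorem 1.2.1)] -/
theorem prob_le_prob_two_mul_div_two {A : ℕ} {y : Site 2} (h : Even ((A : ℤ) + (y 0 + y 1))) :
    prob A y ≤ prob (2 * (A / 2)) 0 := by
  set ν : ℕ → ℝ := fun k => π⁻¹ * ∫ θ in (-(π / 2))..(π / 2), Real.cos θ ^ k with hν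
  have hν0 : ∀ k, 0 ≤ ν k := fun k => mul_nonneg (inv_pos.2 Real.pi_pos).le (integral_cos_pow_half_pos k).le
  have hv : Even ((A : ℤ) + (y 0 - y 1)) := by
    have : (A : ℤ) + (y 0 - y 1) = ((A : ℤ) + (y 0 + y 1)) - 2 * y 1 := by ring
    rw [this]; exact h.sub (even_two_mul _)
  have hq0 : ∀ u : ℤ, 0 ≤ 𝔼 ε : Fin A → Bool, (if (∑ i, if ε i then (1 : ℤ) else -1) = u then (1 : ℝ) else 0) :=
    fun u => expect_nonneg fun _ _ => by split_ifs <;> norm_num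
  rw [prob_eq, expect_ite_endpoint_eq_eq_mul, prob_two_mul_zero_eq_sq_integral, sq]
  have hA : 2 * (A / 2) + A % 2 = A := Nat.div_add_mod A 2
  calc _ ≤ ν A * ν A := mul_le_mul (expect_ite_signSum_le_integral h) (expect_ite_signSum_le_integral hv)
        (hq0 _) (hν0 A)
    _ ≤ ν (2 * (A / 2)) * ν (2 * (A / 2)) := by
        have : ν A ≤ ν (2 * (A / 2)) := by
          simp only [hν]
          refine mul_le_mul_of_nonneg_left ?_ (inv_pos.2 Real.pi_pos).le
          have := integral_cos_pow_add_half_le (2 * (A / 2)) (A % 2)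
          rwa [hA] at this
        exact mul_le_mul this this (hν0 A) (hν0 _)

/-- **Lower comparison**: for `y₀ + y₁ ≡ A (mod 2)`,
`p_A(y) ≥ p_{2⌈A/2⌉}(0) (1 - (π²/4)|y|²/(A+2))`.
[cite: Lawler1991, §1.2 (proof of Theorem 1.2.1)] -/
theorem prob_ge_prob_mul_one_sub {A : ℕ} {y : Site 2} (h : Even ((A : ℤ) + (y 0 + y 1))) :
    prob (2 * ((A + 1) / 2)) 0 * (1 - (π ^ 2 / 4) * normSq y / (A + 2)) ≤ prob A y := by
  set ν : ℕ → ℝ := fun k => π⁻¹ * ∫ θ in (-(π / 2))..(π / 2), Real.cos θ ^ k with hν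
  have hν0 : ∀ k, 0 ≤ ν k := fun k => mul_nonneg (inv_pos.2 Real.pi_pos).le (integral_cos_pow_half_pos k).le
  set u : ℤ := y 0 + y 1 with hu
  set v : ℤ := y 0 - y 1 with hvdef
  have hv : Even ((A : ℤ) + v) := by
    have : (A : ℤ) + v = ((A : ℤ) + u) - 2 * y 1 := by rw [hu, hvdef]; ring
    rw [this]; exact h.sub (even_two_mul _)
  set qu := 𝔼 ε : Fin A → Bool, (if (∑ i, if ε i then (1 : ℤ) else -1) = u then (1 : ℝ) else 0) with hqu
  set qv := 𝔼 ε : Fin A → Bool, (if (∑ i, if ε i then (1 : ℤ) else -1) = v then (1 : ℝ) else 0) with hqv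
  have hq0 : ∀ w : ℤ, 0 ≤ 𝔼 ε : Fin A → Bool, (if (∑ i, if ε i then (1 : ℤ) else -1) = w then (1 : ℝ) else 0) :=
    fun w => expect_nonneg fun _ _ => by split_ifs <;> norm_num
  set κ : ℝ := (π ^ 2 / 8) / (A + 2) with hκ
  have hκ0 : 0 ≤ κ := by positivity
  -- the one-dimensional lower bounds `q ≥ ν (1 - κ w²)`
  have hlow : ∀ w : ℤ, Even ((A : ℤ) + w) →
      ν A * (1 - κ * (w : ℝ) ^ 2) ≤ 𝔼 ε : Fin A → Bool,
        (if (∑ i, if ε i then (1 : ℤ) else -1) = w then (1 : ℝ) else 0) := by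
    intro w hw
    have := integral_sub_expect_ite_signSum_le hw
    simp only [hν, hκ]
    have e : (π ^ 2 / 8) * (w : ℝ) ^ 2 / (A + 2) = (π ^ 2 / 8) / (A + 2) * (w : ℝ) ^ 2 := by ring
    rw [e] at this
    linarith
  -- `a₊ b₊ ≥ a + b - 1`
  have hprod : ν A * ν A * (1 - κ * ((u : ℝ) ^ 2 + (v : ℝ) ^ 2)) ≤ qu * qv := by
    rcases le_or_gt 0 (1 - κ * (u : ℝ) ^ 2) with ha | ha
    · rcases le_or_gt 0 (1 - κ * (v : ℝ) ^ 2) with hb | hb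
      · calc ν A * ν A * (1 - κ * ((u : ℝ) ^ 2 + (v : ℝ) ^ 2))
            ≤ (ν A * (1 - κ * (u : ℝ) ^ 2)) * (ν A * (1 - κ * (v : ℝ) ^ 2)) := by
              have e3 : (ν A * (1 - κ * (u : ℝ) ^ 2)) * (ν A * (1 - κ * (v : ℝ) ^ 2)) -
                  ν A * ν A * (1 - κ * ((u : ℝ) ^ 2 + (v : ℝ) ^ 2)) =
                  ν A * ν A * (κ * (u : ℝ) ^ 2) * (κ * (v : ℝ) ^ 2) := by ring
              refine sub_nonneg.1 ?_
              rw [e3]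
              exact mul_nonneg (mul_nonneg (mul_nonneg (hν0 A) (hν0 A)) (by positivity)) (by positivity)
          _ ≤ qu * qv := mul_le_mul (hlow u h) (hlow v hv) (mul_nonneg (hν0 A) hb) (hq0 u)
      · have : ν A * ν A * (1 - κ * ((u : ℝ) ^ 2 + (v : ℝ) ^ 2)) ≤ 0 := by
          have h1 : 1 - κ * ((u : ℝ) ^ 2 + (v : ℝ) ^ 2) ≤ 0 := by nlinarith [sq_nonneg (u : ℝ)]
          exact mul_nonpos_of_nonneg_of_nonpos (mul_nonneg (hν0 A) (hν0 A)) h1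
        exact this.trans (mul_nonneg (hq0 u) (hq0 v))
    · have : ν A * ν A * (1 - κ * ((u : ℝ) ^ 2 + (v : ℝ) ^ 2)) ≤ 0 := by
        have h1 : 1 - κ * ((u : ℝ) ^ 2 + (v : ℝ) ^ 2) ≤ 0 := by nlinarith [sq_nonneg (v : ℝ)]
        exact mul_nonpos_of_nonneg_of_nonpos (mul_nonneg (hν0 A) (hν0 A)) h1
      exact this.trans (mul_nonneg (hq0 u) (hq0 v))
  -- compare `ν_A²` with `p_{2⌈A/2⌉}(0) = ν_{2⌈A/2⌉}²`, `2⌈A/2⌉ ≥ A`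
  have hA : A ≤ 2 * ((A + 1) / 2) := by omega
  have hνle : ν (2 * ((A + 1) / 2)) ≤ ν A := by
    obtain ⟨s, hs⟩ := Nat.exists_eq_add_of_le hA
    simp only [hν]
    refine mul_le_mul_of_nonneg_left ?_ (inv_pos.2 Real.pi_pos).le
    rw [hs]; exact integral_cos_pow_add_half_le A s
  have huv : (u : ℝ) ^ 2 + (v : ℝ) ^ 2 = 2 * normSq y := by
    simp only [hu, hvdef, normSq, Fin.sum_univ_two]; push_cast; ring
  rw [prob_two_mul_zero_eq_sq_integral, prob_eq A y, expect_ite_endpoint_eq_eq_mul]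
  change ν (2 * ((A + 1) / 2)) ^ 2 * _ ≤ qu * qv
  have e : 1 - π ^ 2 / 4 * normSq y / (A + 2) = 1 - κ * ((u : ℝ) ^ 2 + (v : ℝ) ^ 2) := by
    rw [huv, hκ]; ring
  rw [e]
  rcases le_or_gt 0 (1 - κ * ((u : ℝ) ^ 2 + (v : ℝ) ^ 2)) with hf | hf
  · refine le_trans ?_ hprod
    rw [sq]; exact mul_le_mul_of_nonneg_right (mul_le_mul hνle hνle (hν0 _) (hν0 A)) hf
  · exact (mul_nonpos_of_nonneg_of_nonpos (sq_nonneg _) hf.le).trans (mul_nonneg (hq0 u) (hq0 v))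

/-! ### Return probabilities: monotonicity and increments -/

/-- `p_{2q}(0) = (C(2q,q)/4^q)²`. [cite: Lawler1991, §1.2] -/
theorem prob_two_mul_zero_eq (q : ℕ) : prob (2 * q) 0 = ((Nat.centralBinom q : ℝ) / 4 ^ q) ^ 2 := by
  rw [prob_eq, expect_ite_endpoint_eq_zero_eq_sq, expect_ite_signSum_eq_zero,
    ← Nat.centralBinom_eq_two_mul_choose]

/-- The one-step recursion `C(2q+2,q+1)/4^{q+1} = (C(2q,q)/4^q) (2q+1)/(2q+2)`. [folklore] -/
theorem centralBinom_div_succ (q : ℕ) :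
    (Nat.centralBinom (q + 1) : ℝ) / 4 ^ (q + 1) =
      (Nat.centralBinom q : ℝ) / 4 ^ q * ((2 * q + 1) / (2 * q + 2)) := by
  have h := Nat.succ_mul_centralBinom_succ q
  have h' : ((q : ℝ) + 1) * (Nat.centralBinom (q + 1) : ℝ) = 2 * (2 * q + 1) * Nat.centralBinom q := by
    exact_mod_cast h
  have hq : (q : ℝ) + 1 ≠ 0 := by positivity
  have hcb : (Nat.centralBinom (q + 1) : ℝ) = 2 * (2 * q + 1) * Nat.centralBinom q / (q + 1) := by
    rw [eq_div_iff hq]; linarith [h']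
  rw [hcb, pow_succ]
  field_simp
  ring

/-- **Monotonicity with rate**: `0 ≤ p_{2q}(0) - p_{2q+2}(0) ≤ p_{2q}(0)/(q+1)`. [cite: Lawler1991, Theorem 1.2.1] -/
theorem prob_two_mul_zero_sub_succ (q : ℕ) :
    0 ≤ prob (2 * q) 0 - prob (2 * (q + 1)) 0 ∧
      prob (2 * q) 0 - prob (2 * (q + 1)) 0 ≤ prob (2 * q) 0 / ((q : ℝ) + 1) := by
  rw [prob_two_mul_zero_eq, prob_two_mul_zero_eq, centralBinom_div_succ]
  set b : ℝ := (Nat.centralBinom q : ℝ) / 4 ^ q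
  have hb : 0 ≤ b ^ 2 := sq_nonneg b
  set t : ℝ := (2 * q + 1) / (2 * q + 2) with ht
  have hq : (0 : ℝ) < 2 * q + 2 := by positivity
  have ht1 : t ≤ 1 := by rw [ht, div_le_one hq]; linarith
  have ht0 : 0 ≤ t := by positivity
  have ht2 : 1 - 1 / ((q : ℝ) + 1) ≤ t ^ 2 := by
    have e : t = 1 - 1 / (2 * q + 2) := by rw [ht]; field_simp; ring
    have h3 : (1 - 1 / (2 * (q : ℝ) + 2)) ^ 2 ≥ 1 - 2 * (1 / (2 * q + 2)) := by
      nlinarith [sq_nonneg (1 / (2 * (q : ℝ) + 2))]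
    rw [e]
    calc 1 - 1 / ((q : ℝ) + 1) = 1 - 2 * (1 / (2 * q + 2)) := by
          congr 1; rw [mul_one_div, div_eq_div_iff (by positivity) (by positivity)]; ring
      _ ≤ _ := h3
  have htt : t ^ 2 ≤ 1 := pow_le_one₀ ht0 ht1
  constructor
  · rw [mul_pow]; nlinarith
  · rw [mul_pow]
    have e2 : b ^ 2 - b ^ 2 * t ^ 2 = b ^ 2 * (1 - t ^ 2) := by ring
    rw [e2, div_eq_mul_one_div]
    exact mul_le_mul_of_nonneg_left (by linarith) hb

/-- **Increments of the return probabilities**: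
`0 ≤ p_{2q}(0) - p_{2(q+s)}(0) ≤ 1/(q + ½) - 1/(q + s + ½) (= s/((q+½)(q+s+½)))` (telescoping
`p_{2m} - p_{2m+2} ≤ p_{2m}/(m+1) ≤ 1/((2m+1)(m+1)) ≤ 1/(m+½) - 1/(m+3/2)`).
[cite: Lawler1991, Theorem 1.2.1] -/
theorem prob_two_mul_zero_sub_le (q s : ℕ) :
    0 ≤ prob (2 * q) 0 - prob (2 * (q + s)) 0 ∧
      prob (2 * q) 0 - prob (2 * (q + s)) 0 ≤ 1 / ((q : ℝ) + 1 / 2) - 1 / ((q : ℝ) + s + 1 / 2) := by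
  induction s with
  | zero => simp
  | succ s ih =>
      rw [show q + (s + 1) = q + s + 1 from (add_assoc q s 1).symm]
      have h1 := prob_two_mul_zero_sub_succ (q + s)
      set m : ℝ := (q : ℝ) + s with hm
      have hm0 : 0 ≤ m := by positivity
      have hcast : ((q + s : ℕ) : ℝ) = m := by rw [hm]; push_cast; ring
      have hle' : prob (2 * (q + s)) 0 ≤ 1 / (2 * m + 1) := by
        have := prob_le_inv (2 * (q + s)) 0
        have e : ((2 * (q + s) : ℕ) : ℝ) + 1 = 2 * m + 1 := by rw [hm]; push_cast; ring
        rwa [e] at this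
      have hstep : prob (2 * (q + s)) 0 - prob (2 * (q + s + 1)) 0 ≤ 1 / (m + 1 / 2) - 1 / (m + 3 / 2) := by
        refine h1.2.trans ?_
        calc prob (2 * (q + s)) 0 / (((q + s : ℕ) : ℝ) + 1) = prob (2 * (q + s)) 0 / (m + 1) := by rw [hcast]
          _ ≤ (1 / (2 * m + 1)) / (m + 1) := by gcongr
          _ = 1 / ((2 * m + 1) * (m + 1)) := by rw [div_div]
          _ ≤ 1 / (m + 1 / 2) - 1 / (m + 3 / 2) := by
              rw [div_sub_div _ _ (by positivity) (by positivity),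
                div_le_div_iff₀ (by positivity) (by positivity)]
              nlinarith
      refine ⟨by linarith [ih.1, h1.1], ?_⟩
      calc prob (2 * q) 0 - prob (2 * (q + s + 1)) 0
          = (prob (2 * q) 0 - prob (2 * (q + s)) 0) + (prob (2 * (q + s)) 0 - prob (2 * (q + s + 1)) 0) := by
            ring
        _ ≤ (1 / ((q : ℝ) + 1 / 2) - 1 / ((q : ℝ) + s + 1 / 2)) + (1 / (m + 1 / 2) - 1 / (m + 3 / 2)) :=
            add_le_add ih.2 hstep
        _ = _ := by rw [hm]; push_cast; ring


/-! ### Conditioning bounds on the joint vanishing probability -/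

/-- `j(A,B,C) ≤ p_{A+B}(0)/(C+1)` (condition on the first pair; the second increment then has
`C` free steps). [cite: Lawler1991, Proposition 6.4.1 (proof, the set A³)] -/
theorem pairJoint_le_prob_div (A B C : ℕ) : pairJoint A B C ≤ prob (A + B) 0 / ((C : ℝ) + 1) := by
  have h : ∀ (α : StepSeq A) (β : StepSeq B),
      𝔼 γ : StepSeq C, (if endpoint α + endpoint β = 0 then (1 : ℝ) else 0) *
          (if endpoint β + endpoint γ = 0 then (1 : ℝ) else 0) ≤
        (if endpoint α + endpoint β = 0 then (1 : ℝ) else 0) * (1 / ((C : ℝ) + 1)) := by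
    intro α β
    rw [← Finset.mul_expect]
    refine mul_le_mul_of_nonneg_left ?_ (by split_ifs <;> norm_num)
    have := prob_le_inv C (endpoint β)
    rwa [prob_eq_expect_add] at this
  unfold pairJoint
  calc _ ≤ 𝔼 α : StepSeq A, 𝔼 β : StepSeq B,
        (if endpoint α + endpoint β = 0 then (1 : ℝ) else 0) * (1 / ((C : ℝ) + 1)) :=
        expect_le_expect fun α _ => expect_le_expect fun β _ => h α β
    _ = prob (A + B) 0 / ((C : ℝ) + 1) := by
        rw [prob_add_zero]; simp_rw [← Finset.expect_mul]; ring

/-- `j(A,B,C) ≤ p_{B+C}(0)/(A+1)`. [cite: Lawler1991, Proposition 6.4.1 (proof, the set A³)] -/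
theorem pairJoint_le_prob_div' (A B C : ℕ) : pairJoint A B C ≤ prob (B + C) 0 / ((A : ℝ) + 1) := by
  rw [pairJoint_comm, add_comm B C]
  exact pairJoint_le_prob_div C B A

/-- **The crude bound** (good when the overlap dominates):
`|K(A,B,C)| ≤ 2/((A+1)(B+C+1))`. [cite: Lawler1991, Proposition 6.4.1 (proof)] -/
theorem abs_pairKernel_le_crude (A B C : ℕ) :
    |pairKernel A B C| ≤ 2 / (((A : ℝ) + 1) * (B + C + 1)) := by
  have hj0 := pairJoint_nonneg A B C
  have hj : pairJoint A B C ≤ 1 / (((A : ℝ) + 1) * (B + C + 1)) := by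
    refine (pairJoint_le_prob_div' A B C).trans ?_
    rw [div_le_div_iff₀ (by positivity) (by positivity), one_mul]
    have := prob_le_inv (B + C) 0
    push_cast at this
    calc prob (B + C) 0 * (((A : ℝ) + 1) * (B + C + 1)) = (prob (B + C) 0 * ((B : ℝ) + C + 1)) * (A + 1) := by ring
      _ ≤ 1 * ((A : ℝ) + 1) := by
          gcongr
          rwa [← le_div_iff₀ (by positivity)]
      _ = _ := one_mul _
  have hp0 : 0 ≤ prob (A + B) 0 * prob (B + C) 0 := mul_nonneg (prob_nonneg _ _) (prob_nonneg _ _)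
  have hp : prob (A + B) 0 * prob (B + C) 0 ≤ 1 / (((A : ℝ) + 1) * (B + C + 1)) := by
    have h1 : prob (A + B) 0 ≤ 1 / ((A : ℝ) + 1) := by
      refine (prob_le_inv (A + B) 0).trans ?_
      push_cast
      exact one_div_le_one_div_of_le (by positivity) (by linarith [(B.cast_nonneg : (0 : ℝ) ≤ B)])
    have h2 : prob (B + C) 0 ≤ 1 / ((B : ℝ) + C + 1) := by
      have := prob_le_inv (B + C) 0; push_cast at this; exact this
    calc prob (A + B) 0 * prob (B + C) 0 ≤ (1 / ((A : ℝ) + 1)) * (1 / ((B : ℝ) + C + 1)) :=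
          mul_le_mul h1 h2 (prob_nonneg _ _) (by positivity)
      _ = _ := by rw [one_div_mul_one_div]
  unfold pairKernel
  rw [show (2 : ℝ) / (((A : ℝ) + 1) * (B + C + 1)) = 2 * (1 / (((A : ℝ) + 1) * (B + C + 1))) by ring]
  have : (0 : ℝ) ≤ 1 / (((A : ℝ) + 1) * (B + C + 1)) := by positivity
  rw [abs_le]
  constructor <;> linarith

/-! ### The refined bound (good when a private part dominates) -/

/-- `p_{B+C}(0) = 𝔼_β p_C(Y_B)`. [cite: Lawler1991, §1.3 (Theorem 1.3.2)] -/
theorem prob_add_zero_eq_expect_prob (B C : ℕ) :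
    prob (B + C) 0 = 𝔼 β : StepSeq B, prob C (endpoint β) := by
  rw [prob_add_zero]
  exact Finset.expect_congr rfl fun β _ => (prob_eq_expect_add C (endpoint β)).symm

/-- **Conditioning on the shared increment**:
`K(A,B,C) = 𝔼_β [p_C(Y_B) (p_A(Y_B) - p_{A+B}(0))]`. [cite: Stoll1989, §1 (proof of Proposition 1.10)] -/
theorem pairKernel_eq_expect (A B C : ℕ) :
    pairKernel A B C =
      𝔼 β : StepSeq B, prob C (endpoint β) * (prob A (endpoint β) - prob (A + B) 0) := by
  unfold pairKernel
  rw [pairJoint_eq_expect_prob, prob_add_zero_eq_expect_prob B C, Finset.mul_expect,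
    ← Finset.expect_sub_distrib]
  exact Finset.expect_congr rfl fun β _ => by ring

/-- `|x|²` is even. [folklore] -/
theorem normSq_neg (x : Site 2) : normSq (-x) = normSq x := by
  unfold normSq
  simp only [Pi.neg_apply, Int.cast_neg, neg_sq]

/-- **Swap identity**: `𝔼_β [p_C(Y_B) |Y_B|²] = 𝔼_γ [p_B(W_C) |W_C|²]` (both are
`Σ_y p_B(y) p_C(y) |y|²`). [folklore] -/
theorem expect_prob_mul_normSq_comm (B C : ℕ) :
    𝔼 β : StepSeq B, prob C (endpoint β) * normSq (endpoint β) =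
      𝔼 γ : StepSeq C, prob B (endpoint γ) * normSq (endpoint γ) := by
  simp_rw [prob_eq_expect_add, Finset.expect_mul]
  rw [Finset.expect_comm]
  refine Finset.expect_congr rfl fun γ _ => Finset.expect_congr rfl fun β _ => ?_
  by_cases h : endpoint β + endpoint γ = 0
  · rw [if_pos h, if_pos (by rw [add_comm]; exact h), eq_neg_of_add_eq_zero_left h, normSq_neg]
  · rw [if_neg h, if_neg (by rw [add_comm]; exact h), zero_mul, zero_mul]

/-- `𝔼_β [p_C(Y_B) |Y_B|²] ≤ 1` (`≤ min(B/(C+1), C/(B+1))` by the local bound, `E|Y_B|² = B` and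
the swap identity). [folklore] -/
theorem expect_prob_mul_normSq_le_one (B C : ℕ) :
    𝔼 β : StepSeq B, prob C (endpoint β) * normSq (endpoint β) ≤ 1 := by
  have key : ∀ B C : ℕ, 𝔼 β : StepSeq B, prob C (endpoint β) * normSq (endpoint β) ≤ B / ((C : ℝ) + 1) := by
    intro B C
    calc 𝔼 β : StepSeq B, prob C (endpoint β) * normSq (endpoint β)
        ≤ 𝔼 β : StepSeq B, (1 / ((C : ℝ) + 1)) * normSq (endpoint β) :=
          expect_le_expect fun β _ => mul_le_mul_of_nonneg_right (prob_le_inv C _) (normSq_nonneg' _)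
      _ = B / ((C : ℝ) + 1) := by rw [← Finset.mul_expect, expect_normSq_endpoint]; ring
  rcases le_or_gt B C with h | h
  · refine (key B C).trans ?_
    rw [div_le_one (by positivity)]
    have : (B : ℝ) ≤ C := by exact_mod_cast h
    linarith
  · rw [expect_prob_mul_normSq_comm]
    refine (key C B).trans ?_
    rw [div_le_one (by positivity)]
    have : (C : ℝ) + 1 ≤ B := by exact_mod_cast h
    linarith

/-- **The refined bound, core form**: for `1 ≤ A`, `1 ≤ B`, `A + B` even,
`|K(A,B,C)| ≤ 2(B+1)/(A(A+B+1)(B+C+1)) + (π²/4)/((A+1)(A+2))`: on the parity class of `Y_B`,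
`p_A(Y_B)` lies between `p_{2⌈A/2⌉}(0)(1 - (π²/4)|Y_B|²/(A+2))` and `p_{2⌊A/2⌋}(0)`, and
`p_{2⌊A/2⌋}(0) - p_{A+B}(0) ≤ 2(B+1)/(A(A+B+1))`. [cite: Stoll1989, §1, Proposition 1.10 (proof)] -/
theorem abs_pairKernel_le_core {A B C : ℕ} (hA1 : 1 ≤ A) (hB1 : 1 ≤ B) (hAB : Even (A + B)) :
    |pairKernel A B C| ≤
      2 * ((B : ℝ) + 1) / (A * (A + B + 1) * (B + C + 1)) + (π ^ 2 / 4) / (((A : ℝ) + 1) * (A + 2)) := by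
  set U := prob (2 * (A / 2)) 0 with hU
  set L := prob (2 * ((A + 1) / 2)) 0 with hL
  set P := prob (A + B) 0 with hP
  -- the return probability at time `A + B` is below both references
  have hq2 : 2 * (A / 2) ≤ A := Nat.mul_div_le A 2
  obtain ⟨sU, hsU⟩ : ∃ s, A + B = 2 * (A / 2 + s) := by
    obtain ⟨t, ht⟩ := hAB
    refine ⟨t - A / 2, ?_⟩; omega
  obtain ⟨sL, hsL⟩ : ∃ s, A + B = 2 * ((A + 1) / 2 + s) := by
    obtain ⟨t, ht⟩ := hAB
    refine ⟨t - (A + 1) / 2, ?_⟩; omega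
  have hD := prob_two_mul_zero_sub_le (A / 2) sU
  rw [← hsU] at hD
  have hDL := prob_two_mul_zero_sub_le ((A + 1) / 2) sL
  rw [← hsL] at hDL
  -- `D = U - P ≤ 2(B+1)/(A(A+B+1))`
  have hD2 : U - P ≤ 2 * ((B : ℝ) + 1) / (A * (A + B + 1)) := by
    refine hD.2.trans ?_
    have hA0 : (0 : ℝ) < A := by exact_mod_cast hA1
    have hq : (A : ℝ) / 2 ≤ (A / 2 : ℕ) + 1 / 2 := by
      have : (A : ℝ) ≤ 2 * (A / 2 : ℕ) + 1 := by exact_mod_cast (by omega : A ≤ 2 * (A / 2) + 1)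
      linarith
    have hqs : ((A / 2 : ℕ) : ℝ) + sU + 1 / 2 = ((A : ℝ) + B + 1) / 2 := by
      have : ((A + B : ℕ) : ℝ) = 2 * ((A / 2 : ℕ) + sU) := by exact_mod_cast hsU
      push_cast at this; linarith
    have hs : (sU : ℝ) ≤ ((B : ℝ) + 1) / 2 := by
      have : 2 * ((A / 2 : ℕ) + sU) ≤ (2 * (A / 2) + 1) + B := by omega
      have : ((2 * ((A / 2 : ℕ) + sU) : ℕ) : ℝ) ≤ (((2 * (A / 2) + 1) + B : ℕ) : ℝ) := by exact_mod_cast this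
      push_cast at this; linarith
    rw [hqs, div_sub_div _ _ (by positivity) (by positivity)]
    rw [div_le_div_iff₀ (by positivity) (by positivity)]
    have e : (1 * (((A : ℝ) + B + 1) / 2) - ((A / 2 : ℕ) + 1 / 2) * 1) = sU := by linarith
    rw [e]
    have h1 : (sU : ℝ) * ((A : ℝ) * (A + B + 1)) ≤ (((B : ℝ) + 1) / 2) * ((A : ℝ) * (A + B + 1)) :=
      mul_le_mul_of_nonneg_right hs (by positivity)
    have h2 : 2 * ((B : ℝ) + 1) * ((((A / 2 : ℕ) : ℝ) + 1 / 2) * (((A : ℝ) + B + 1) / 2)) ≥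
        2 * ((B : ℝ) + 1) * (((A : ℝ) / 2) * (((A : ℝ) + B + 1) / 2)) := by gcongr
    nlinarith
  -- pointwise bound on `|p_A(Y) - P|`
  have hpt : ∀ β : StepSeq B, |prob A (endpoint β) - P| ≤
      (U - P) + L * ((π ^ 2 / 4) / ((A : ℝ) + 2)) * normSq (endpoint β) := by
    intro β
    have hpar : Even ((A : ℤ) + (endpoint β 0 + endpoint β 1)) := by
      have h1 := even_add_endpoint_sum β
      have h2 : Even ((A : ℤ) + B) := by exact_mod_cast hAB
      have : (A : ℤ) + (endpoint β 0 + endpoint β 1) =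
          ((A : ℤ) + B) + ((B : ℤ) + (endpoint β 0 + endpoint β 1)) - 2 * B := by ring
      rw [this]; exact (h2.add h1).sub (even_two_mul _)
    have hup : prob A (endpoint β) ≤ U := prob_le_prob_two_mul_div_two hpar
    have hlo := prob_ge_prob_mul_one_sub hpar
    have hLP : P ≤ L := by linarith [hDL.1]
    have hL0 : 0 ≤ L := prob_nonneg _ _
    have hn0 : 0 ≤ normSq (endpoint β) := normSq_nonneg' _
    rw [abs_le]
    constructor
    · -- `P - p_A(Y) ≤ (P - L) + L c n/(A+2) ≤ L c n/(A+2)`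
      have : L * (1 - π ^ 2 / 4 * normSq (endpoint β) / (A + 2)) =
          L - L * (π ^ 2 / 4 / ((A : ℝ) + 2)) * normSq (endpoint β) := by ring
      rw [this] at hlo
      have hUP : 0 ≤ U - P := hD.1
      nlinarith
    · have : 0 ≤ L * (π ^ 2 / 4 / ((A : ℝ) + 2)) * normSq (endpoint β) := by positivity
      linarith
  -- integrate
  rw [pairKernel_eq_expect]
  refine (Finset.abs_expect_le _ _).trans ?_
  have hL1 : L ≤ 1 / ((A : ℝ) + 1) := by
    refine (prob_le_inv _ _).trans ?_
    exact one_div_le_one_div_of_le (by positivity) (by exact_mod_cast (by omega : A + 1 ≤ 2 * ((A + 1) / 2) + 1))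
  calc 𝔼 β : StepSeq B, |prob C (endpoint β) * (prob A (endpoint β) - P)|
      ≤ 𝔼 β : StepSeq B, ((U - P) * prob C (endpoint β) +
          L * ((π ^ 2 / 4) / ((A : ℝ) + 2)) * (prob C (endpoint β) * normSq (endpoint β))) := by
        refine expect_le_expect fun β _ => ?_
        rw [abs_mul, abs_of_nonneg (prob_nonneg _ _)]
        calc prob C (endpoint β) * |prob A (endpoint β) - P|
            ≤ prob C (endpoint β) * ((U - P) + L * ((π ^ 2 / 4) / ((A : ℝ) + 2)) * normSq (endpoint β)) :=
              mul_le_mul_of_nonneg_left (hpt β) (prob_nonneg _ _)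
          _ = _ := by ring
    _ = (U - P) * prob (B + C) 0 +
          L * ((π ^ 2 / 4) / ((A : ℝ) + 2)) * 𝔼 β : StepSeq B, prob C (endpoint β) * normSq (endpoint β) := by
        rw [Finset.expect_add_distrib, ← Finset.mul_expect, ← Finset.mul_expect, prob_add_zero_eq_expect_prob]
    _ ≤ (2 * ((B : ℝ) + 1) / (A * (A + B + 1))) * (1 / ((B : ℝ) + C + 1)) +
          (1 / ((A : ℝ) + 1)) * ((π ^ 2 / 4) / ((A : ℝ) + 2)) * 1 := by
        have hBC : prob (B + C) 0 ≤ 1 / ((B : ℝ) + C + 1) := by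
          have := prob_le_inv (B + C) 0; push_cast at this; exact this
        have t1 : (U - P) * prob (B + C) 0 ≤ (2 * ((B : ℝ) + 1) / (A * (A + B + 1))) * (1 / ((B : ℝ) + C + 1)) :=
          mul_le_mul hD2 hBC (prob_nonneg _ _) (by positivity)
        have hE0 : 0 ≤ 𝔼 β : StepSeq B, prob C (endpoint β) * normSq (endpoint β) :=
          expect_nonneg fun β _ => mul_nonneg (prob_nonneg _ _) (normSq_nonneg' _)
        have t2 : L * ((π ^ 2 / 4) / ((A : ℝ) + 2)) * 𝔼 β : StepSeq B, prob C (endpoint β) * normSq (endpoint β) ≤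
            (1 / ((A : ℝ) + 1)) * ((π ^ 2 / 4) / ((A : ℝ) + 2)) * 1 :=
          mul_le_mul (mul_le_mul_of_nonneg_right hL1 (by positivity)) (expect_prob_mul_normSq_le_one B C)
            hE0 (by positivity)
        exact add_le_add t1 t2
    _ = _ := by
        have hA0 : (A : ℝ) ≠ 0 := by exact_mod_cast (by omega : A ≠ 0)
        field_simp

/-- `π²/4 ≤ 5/2`. [folklore] -/
theorem pi_sq_div_four_le : π ^ 2 / 4 ≤ 5 / 2 := by
  nlinarith [Real.pi_lt_d2, Real.pi_pos]

/-- **The refined bound**: for `1 ≤ B ≤ A`, `C ≤ A` (the first private part is the largest of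
the three numbers), `|K(A,B,C)| ≤ 16/((A+1)(A+B+C+1))`. [cite: Stoll1989, §1, Proposition 1.10] -/
theorem abs_pairKernel_le_of_max_left {A B C : ℕ} (hB1 : 1 ≤ B) (hBA : B ≤ A) (hCA : C ≤ A) :
    |pairKernel A B C| ≤ 16 / (((A : ℝ) + 1) * (A + B + C + 1)) := by
  have hA1 : 1 ≤ A := hB1.trans hBA
  have hpos : (0 : ℝ) < ((A : ℝ) + 1) * (A + B + C + 1) := by positivity
  by_cases hAB : Even (A + B)
  swap
  · rw [pairKernel_eq_zero_of_odd_left hAB, abs_zero]; positivity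
  refine (abs_pairKernel_le_core hA1 hB1 hAB).trans ?_
  have hA : (1 : ℝ) ≤ A := by exact_mod_cast hA1
  have hB : (B : ℝ) ≤ A := by exact_mod_cast hBA
  have hC : (C : ℝ) ≤ A := by exact_mod_cast hCA
  have hB0 : (0 : ℝ) ≤ B := B.cast_nonneg
  have hC0 : (0 : ℝ) ≤ C := C.cast_nonneg
  -- first summand: `2(B+1)/(A(A+B+1)(B+C+1)) = (2/A)((B+1)/(B+C+1))(1/(A+B+1)) ≤ (4/(A+1)) 1 (2/(A+B+C+1))`
  have h1 : 2 * ((B : ℝ) + 1) / (A * (A + B + 1) * (B + C + 1)) ≤ 8 / (((A : ℝ) + 1) * (A + B + C + 1)) := by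
    rw [div_le_div_iff₀ (by positivity) hpos]
    have e1 : (B : ℝ) + 1 ≤ B + C + 1 := by linarith
    have e2 : (A : ℝ) + 1 ≤ 2 * A := by linarith
    have e3 : (A : ℝ) + B + C + 1 ≤ 2 * (A + B + 1) := by linarith
    calc 2 * ((B : ℝ) + 1) * ((A + 1) * (A + B + C + 1))
        ≤ 2 * ((B : ℝ) + C + 1) * ((2 * A) * (2 * (A + B + 1))) := by gcongr
      _ = 8 * ((A : ℝ) * (A + B + 1) * (B + C + 1)) := by ring
  -- second summand: `(π²/4)/((A+1)(A+2)) ≤ (5/2) 3/((A+1)(A+B+C+1))`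
  have h2 : (π ^ 2 / 4) / (((A : ℝ) + 1) * (A + 2)) ≤ 8 / (((A : ℝ) + 1) * (A + B + C + 1)) := by
    calc (π ^ 2 / 4) / (((A : ℝ) + 1) * (A + 2)) ≤ (5 / 2) / (((A : ℝ) + 1) * (A + 2)) :=
          div_le_div_of_nonneg_right pi_sq_div_four_le (by positivity)
      _ ≤ 8 / (((A : ℝ) + 1) * (A + B + C + 1)) := by
          rw [div_le_div_iff₀ (by positivity) hpos]
          have e3 : (A : ℝ) + B + C + 1 ≤ 3 * (A + 2) := by linarith
          calc 5 / 2 * (((A : ℝ) + 1) * (A + B + C + 1)) ≤ 5 / 2 * (((A : ℝ) + 1) * (3 * (A + 2))) := by gcongr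
            _ ≤ 8 * (((A : ℝ) + 1) * (A + 2)) := by nlinarith
  calc _ ≤ 8 / (((A : ℝ) + 1) * (A + B + C + 1)) + 8 / (((A : ℝ) + 1) * (A + B + C + 1)) := add_le_add h1 h2
    _ = _ := by ring

/-- **The universal bound on the pair kernel**:
`|K(A,B,C)| ≤ 16/((max(A,C)+1)(A+B+C+1))` for all `A, B, C`. When the overlap `B` is the
largest of the three numbers this is the crude conditioning bound; otherwise the larger private
part `A` (or `C`) dominates and the cancellation `p_A(y) ≈ p_{A+B}(0)` for `|y|² ≲ B` is used
(`abs_pairKernel_le_of_max_left`). [cite: Stoll1989, §1, Proposition 1.10] [cite: Lawler1991, Proposition 6.4.1 (proof)] -/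
theorem abs_pairKernel_le (A B C : ℕ) :
    |pairKernel A B C| ≤ 16 / ((((max A C : ℕ) : ℝ) + 1) * ((A : ℝ) + B + C + 1)) := by
  -- reduce to `C ≤ A` by the symmetry of the kernel
  wlog hCA : C ≤ A generalizing A C
  · have h := this C A (le_of_not_ge hCA)
    rw [pairKernel_comm, max_comm]
    exact h.trans (le_of_eq (by ring))
  rw [max_eq_left hCA]
  rcases Nat.eq_zero_or_pos B with rfl | hB1
  · rw [pairKernel_zero_mid, abs_zero]; positivity
  rcases le_or_gt B A with hBA | hAB
  · exact abs_pairKernel_le_of_max_left hB1 hBA hCA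
  · -- the overlap is the largest: crude bound
    refine (abs_pairKernel_le_crude A B C).trans ?_
    rw [div_le_div_iff₀ (by positivity) (by positivity)]
    have hB : (A : ℝ) + 1 ≤ B := by exact_mod_cast hAB
    have hC : (C : ℝ) ≤ A := by exact_mod_cast hCA
    have e : (A : ℝ) + B + C + 1 ≤ 2 * (B + C + 1) := by linarith
    calc 2 * (((A : ℝ) + 1) * (A + B + C + 1)) ≤ 2 * (((A : ℝ) + 1) * (2 * (B + C + 1))) := by gcongr
      _ ≤ 16 * (((A : ℝ) + 1) * (B + C + 1)) := by nlinarith [(A.cast_nonneg : (0 : ℝ) ≤ A), (B.cast_nonneg : (0 : ℝ) ≤ B), (C.cast_nonneg : (0 : ℝ) ≤ C)]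


/-! ### The kernel at the overlap data of two time pairs: a universal bound and slab sums -/

/-- `|a - b| = max a b - min a b` for naturals, as reals. [folklore] -/
theorem abs_natCast_sub_eq (a b : ℕ) : |(a : ℝ) - b| = ((max a b - min a b : ℕ) : ℝ) := by
  rcases le_total a b with h | h
  · rw [max_eq_right h, min_eq_left h, Nat.cast_sub h, abs_sub_comm, abs_of_nonneg (by
      have : (a : ℝ) ≤ b := by exact_mod_cast h
      linarith)]
  · rw [max_eq_left h, min_eq_right h, Nat.cast_sub h, abs_of_nonneg (by
      have : (b : ℝ) ≤ a := by exact_mod_cast h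
      linarith)]

/-- **Universal bound at the overlap data** ("private lengths times range"): for all `r` and all
times `i, j, k, l`, with `i₁ = i ∧ j`, `j₁ = i ∨ j`, `k₁ = k ∧ l`, `l₁ = k ∨ l`,
`|pairKernelAt r i j k l| ≤ 32 / ((|i₁ - k₁| + |j₁ - l₁| + 1)(max - min + 1))` (`max`, `min` over
the four times): by `abs_pairKernel_le`, since for overlapping pairs `A + C = |i₁ - k₁| + |j₁ - l₁|`,
`A + B + C = max - min`, and lengthening the second pair only helps. [cite: Stoll1989, §1, Proposition 1.10] -/
theorem abs_pairKernelAt_le_strong (r i j k l : ℕ) :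
    |pairKernelAt r i j k l| ≤
      32 / ((|((min i j : ℕ) : ℝ) - (min k l : ℕ)| + |((max i j : ℕ) : ℝ) - (max k l : ℕ)| + 1) *
        (((max (max i j) (max k l) : ℕ) : ℝ) - (min (min i j) (min k l) : ℕ) + 1)) := by
  have hR0 : (0 : ℝ) ≤ ((max (max i j) (max k l) : ℕ) : ℝ) - (min (min i j) (min k l) : ℕ) := by
    have : min (min i j) (min k l) ≤ max (max i j) (max k l) :=
      (min_le_left _ _).trans ((min_le_left _ _).trans ((le_max_left _ _).trans (le_max_left _ _)))
    have : ((min (min i j) (min k l) : ℕ) : ℝ) ≤ (max (max i j) (max k l) : ℕ) := by exact_mod_cast this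
    linarith
  have hpos : (0 : ℝ) < (|((min i j : ℕ) : ℝ) - (min k l : ℕ)| + |((max i j : ℕ) : ℝ) - (max k l : ℕ)| + 1) *
      (((max (max i j) (max k l) : ℕ) : ℝ) - (min (min i j) (min k l) : ℕ) + 1) := by positivity
  unfold pairKernelAt
  set i₁ := min i j with hi₁
  set j₁ := max i j with hj₁
  set k₁ := min k l with hk₁
  set l₁ := max k l with hl₁
  have hij : i₁ ≤ j₁ := min_le_max
  have hkl : k₁ ≤ l₁ := min_le_max
  have hB : overlapLen i j k l = min j₁ l₁ - max i₁ k₁ := rfl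
  rw [hB]
  set B := min j₁ l₁ - max i₁ k₁ with hBdef
  rcases Nat.eq_zero_or_pos B with hB0 | hB1
  · rw [hB0, pairKernel_zero_mid, abs_zero]; positivity
  set A := j₁ - i₁ - B with hA
  set C := l₁ - k₁ - B with hC
  have key := abs_pairKernel_le A B (C + 2 * r)
  refine key.trans ?_
  -- the combinatorics of the overlap data
  have hAC : A + C = (max i₁ k₁ - min i₁ k₁) + (max j₁ l₁ - min j₁ l₁) := by omega
  have hABC : A + B + C = max j₁ l₁ - min i₁ k₁ := by omega
  have e1 : |((i₁ : ℕ) : ℝ) - (k₁ : ℕ)| + |((j₁ : ℕ) : ℝ) - (l₁ : ℕ)| = ((A + C : ℕ) : ℝ) := by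
    rw [abs_natCast_sub_eq, abs_natCast_sub_eq, hAC]; push_cast; ring
  have e2 : ((max j₁ l₁ : ℕ) : ℝ) - (min i₁ k₁ : ℕ) = ((A + B + C : ℕ) : ℝ) := by
    rw [hABC, Nat.cast_sub]; omega
  rw [show max (max i j) (max k l) = max j₁ l₁ from rfl, show min (min i j) (min k l) = min i₁ k₁ from rfl,
    e1, e2]
  rw [div_le_div_iff₀ (by positivity) (by positivity)]
  have h1 : ((A + C : ℕ) : ℝ) + 1 ≤ 2 * (((max A (C + 2 * r) : ℕ) : ℝ) + 1) := by
    have : A + C + 1 ≤ 2 * (max A (C + 2 * r) + 1) := by omega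
    exact_mod_cast this
  have h2 : ((A + B + C : ℕ) : ℝ) + 1 ≤ (A : ℝ) + B + (C + 2 * r : ℕ) + 1 := by
    push_cast; linarith [(r.cast_nonneg : (0 : ℝ) ≤ r)]
  have h3 : (0 : ℝ) ≤ ((max A (C + 2 * r) : ℕ) : ℝ) + 1 := by positivity
  have h4 : (0 : ℝ) ≤ ((A + C : ℕ) : ℝ) + 1 := by positivity
  calc 16 * ((((A + C : ℕ) : ℝ) + 1) * (((A + B + C : ℕ) : ℝ) + 1))
      ≤ 16 * ((2 * (((max A (C + 2 * r) : ℕ) : ℝ) + 1)) * ((A : ℝ) + B + (C + 2 * r : ℕ) + 1)) := by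
        gcongr
    _ = 32 * ((((max A (C + 2 * r) : ℕ) : ℝ) + 1) * ((A : ℝ) + B + (C + 2 * r : ℕ) + 1)) := by ring

/-- **Product form** of the universal bound:
`|pairKernelAt r i j k l| ≤ 32 / ((|i₁ - k₁| + 1)(|j₁ - l₁| + 1))`. [cite: Stoll1989, §1, Proposition 1.10] -/
theorem abs_pairKernelAt_le_prod (r i j k l : ℕ) :
    |pairKernelAt r i j k l| ≤
      32 / ((|((min i j : ℕ) : ℝ) - (min k l : ℕ)| + 1) * (|((max i j : ℕ) : ℝ) - (max k l : ℕ)| + 1)) := by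
  refine (abs_pairKernelAt_le_strong r i j k l).trans ?_
  have hR : |((max i j : ℕ) : ℝ) - (max k l : ℕ)| ≤
      ((max (max i j) (max k l) : ℕ) : ℝ) - (min (min i j) (min k l) : ℕ) := by
    rw [abs_natCast_sub_eq]
    have : max (max i j) (max k l) - min (max i j) (max k l) + min (min i j) (min k l) ≤
        max (max i j) (max k l) := by omega
    have : ((max (max i j) (max k l) - min (max i j) (max k l) : ℕ) : ℝ) + (min (min i j) (min k l) : ℕ) ≤
        (max (max i j) (max k l) : ℕ) := by exact_mod_cast this
    linarith
  have h0 : (0 : ℝ) ≤ |((max i j : ℕ) : ℝ) - (max k l : ℕ)| := abs_nonneg _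
  refine div_le_div_of_nonneg_left (by norm_num) (by positivity) ?_
  refine mul_le_mul ?_ ?_ (by positivity) (by positivity)
  · linarith [abs_nonneg (((max i j : ℕ) : ℝ) - (max k l : ℕ))]
  · linarith

/-- `Σ_{k<M} 1/(k+1) ≤ 1 + log M`. [folklore] -/
theorem sum_range_one_div_succ_le_log (M : ℕ) :
    ∑ k ∈ range M, 1 / ((k : ℝ) + 1) ≤ 1 + Real.log M := by
  have h := harmonic_le_one_add_log M
  simp only [harmonic] at h
  push_cast at h
  simpa [one_div] using h

/-- `Σ_{k<M} 1/(|a - k| + 1) ≤ 2 (1 + log M)` for `a < M`. [folklore] -/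
theorem sum_range_one_div_abs_sub_le (M a : ℕ) (ha : a < M) :
    ∑ k ∈ range M, 1 / (|(a : ℝ) - k| + 1) ≤ 2 * (1 + Real.log M) := by
  have hH := sum_range_one_div_succ_le_log M
  rw [Finset.range_eq_Ico, ← Finset.sum_Ico_consecutive _ (Nat.zero_le (a + 1)) (by omega : a + 1 ≤ M)]
  -- `k ≤ a`: a reflected harmonic sum
  have h1 : ∑ k ∈ Ico 0 (a + 1), 1 / (|(a : ℝ) - k| + 1) = ∑ d ∈ range (a + 1), 1 / ((d : ℝ) + 1) := by
    rw [← Finset.range_eq_Ico, ← Finset.sum_range_reflect (fun d : ℕ => 1 / ((d : ℝ) + 1)) (a + 1)]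
    refine Finset.sum_congr rfl fun k hk => ?_
    have hk' : k ≤ a := Nat.lt_succ_iff.1 (mem_range.1 hk)
    rw [show a + 1 - 1 - k = a - k by omega, Nat.cast_sub hk', abs_of_nonneg (by
      have : (k : ℝ) ≤ a := by exact_mod_cast hk'
      linarith)]
  have h1' : ∑ d ∈ range (a + 1), 1 / ((d : ℝ) + 1) ≤ ∑ d ∈ range M, 1 / ((d : ℝ) + 1) :=
    Finset.sum_le_sum_of_subset_of_nonneg (Finset.range_subset_range.2 (by omega)) fun _ _ _ => by positivity
  -- `k > a`: a shifted harmonic sum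
  have h2 : ∑ k ∈ Ico (a + 1) M, 1 / (|(a : ℝ) - k| + 1) ≤ ∑ d ∈ range M, 1 / ((d : ℝ) + 1) := by
    rw [Finset.sum_Ico_eq_sum_range]
    calc ∑ d ∈ range (M - (a + 1)), 1 / (|(a : ℝ) - ((a + 1 + d : ℕ) : ℝ)| + 1)
        ≤ ∑ d ∈ range (M - (a + 1)), 1 / ((d : ℝ) + 1) := by
          refine Finset.sum_le_sum fun d _ => ?_
          rw [show |(a : ℝ) - ((a + 1 + d : ℕ) : ℝ)| = d + 1 by
            push_cast; rw [abs_of_nonpos (by linarith)]; ring]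
          exact one_div_le_one_div_of_le (by positivity) (by linarith)
      _ ≤ ∑ d ∈ range M, 1 / ((d : ℝ) + 1) :=
          Finset.sum_le_sum_of_subset_of_nonneg (Finset.range_subset_range.2 (by omega)) fun _ _ _ => by positivity
  linarith [h1.le, h1.ge]

/-- **Slab sums of the bound**: for `a₀ < M`,
`Σ_{j,k,l<M} 32/((|a₀∧j - k∧l| + 1)(|a₀∨j - k∨l| + 1)) ≤ 256 M (1 + log M)²`. [folklore] -/
theorem slab_bound_sum_le (M a₀ : ℕ) (ha : a₀ < M) :
    ∑ j ∈ range M, ∑ k ∈ range M, ∑ l ∈ range M,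
        32 / ((|((min a₀ j : ℕ) : ℝ) - (min k l : ℕ)| + 1) * (|((max a₀ j : ℕ) : ℝ) - (max k l : ℕ)| + 1)) ≤
      256 * M * (1 + Real.log M) ^ 2 := by
  set H : ℝ := 1 + Real.log M with hHdef
  have hg : ∀ a : ℕ, a < M → ∑ k ∈ range M, 1 / (|(a : ℝ) - k| + 1) ≤ 2 * H :=
    fun a ha => sum_range_one_div_abs_sub_le M a ha
  have hH0 : 0 ≤ H := by
    rcases Nat.eq_zero_or_pos M with h | h
    · omega
    · have := hg 0 h
      have h0 : 0 ≤ ∑ k ∈ range M, 1 / (|((0 : ℕ) : ℝ) - k| + 1) := Finset.sum_nonneg fun _ _ => by positivity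
      linarith
  have inner : ∀ j ∈ range M, ∑ k ∈ range M, ∑ l ∈ range M,
      32 / ((|((min a₀ j : ℕ) : ℝ) - (min k l : ℕ)| + 1) * (|((max a₀ j : ℕ) : ℝ) - (max k l : ℕ)| + 1)) ≤
      256 * H ^ 2 := by
    intro j hj
    rw [mem_range] at hj
    set a := min a₀ j with hadef
    set b := max a₀ j with hbdef
    have haM : a < M := (min_le_left _ _).trans_lt ha
    have hbM : b < M := max_lt ha hj
    -- bound each term by the sum over the two orderings of `(k, l)`
    have hterm : ∀ k l : ℕ,
        32 / ((|(a : ℝ) - (min k l : ℕ)| + 1) * (|(b : ℝ) - (max k l : ℕ)| + 1)) ≤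
          32 * ((1 / (|(a : ℝ) - k| + 1)) * (1 / (|(b : ℝ) - l| + 1)) +
            (1 / (|(a : ℝ) - l| + 1)) * (1 / (|(b : ℝ) - k| + 1))) := by
      intro k l
      have hpos1 : (0 : ℝ) < (1 / (|(a : ℝ) - k| + 1)) * (1 / (|(b : ℝ) - l| + 1)) := by positivity
      have hpos2 : (0 : ℝ) < (1 / (|(a : ℝ) - l| + 1)) * (1 / (|(b : ℝ) - k| + 1)) := by positivity
      rcases le_total k l with h | h
      · rw [min_eq_left h, max_eq_right h, div_eq_mul_one_div, ← one_div_mul_one_div]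
        nlinarith
      · rw [min_eq_right h, max_eq_left h, div_eq_mul_one_div, ← one_div_mul_one_div]
        nlinarith
    calc _ ≤ ∑ k ∈ range M, ∑ l ∈ range M, 32 * ((1 / (|(a : ℝ) - k| + 1)) * (1 / (|(b : ℝ) - l| + 1)) +
            (1 / (|(a : ℝ) - l| + 1)) * (1 / (|(b : ℝ) - k| + 1))) :=
          Finset.sum_le_sum fun k _ => Finset.sum_le_sum fun l _ => hterm k l
      _ = 32 * (2 * ((∑ k ∈ range M, 1 / (|(a : ℝ) - k| + 1)) * (∑ l ∈ range M, 1 / (|(b : ℝ) - l| + 1)))) := by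
          have hS : ∑ k ∈ range M, ∑ l ∈ range M, (1 / (|(a : ℝ) - l| + 1)) * (1 / (|(b : ℝ) - k| + 1)) =
              ∑ k ∈ range M, ∑ l ∈ range M, (1 / (|(a : ℝ) - k| + 1)) * (1 / (|(b : ℝ) - l| + 1)) := by
            rw [Finset.sum_comm]
          have hP : ∑ k ∈ range M, ∑ l ∈ range M, (1 / (|(a : ℝ) - k| + 1)) * (1 / (|(b : ℝ) - l| + 1)) =
              (∑ k ∈ range M, 1 / (|(a : ℝ) - k| + 1)) * (∑ l ∈ range M, 1 / (|(b : ℝ) - l| + 1)) :=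
            (Finset.sum_mul_sum _ _ _ _).symm
          simp_rw [← Finset.mul_sum, Finset.sum_add_distrib]
          rw [hS, hP]
          ring
      _ ≤ 32 * (2 * ((2 * H) * (2 * H))) := by
          have hsa := hg a haM
          have hsb := hg b hbM
          have h0a : 0 ≤ ∑ k ∈ range M, 1 / (|(a : ℝ) - k| + 1) := Finset.sum_nonneg fun _ _ => by positivity
          gcongr
      _ = 256 * H ^ 2 := by ring
  calc _ ≤ ∑ _j ∈ range M, 256 * H ^ 2 := Finset.sum_le_sum inner
    _ = 256 * M * (1 + Real.log M) ^ 2 := by rw [Finset.sum_const, Finset.card_range, nsmul_eq_mul, hHdef]; ring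

/-- **Slab sum, first time fixed**: `Σ_{j,k,l<M} |pairKernelAt r i₀ j k l| ≤ 256 M (1 + log M)²`
for `i₀ < M`. [cite: Stoll1989, §1, Proposition 1.10] -/
theorem slab_sum_abs_pairKernelAt_le (r M i₀ : ℕ) (hi : i₀ < M) :
    ∑ j ∈ range M, ∑ k ∈ range M, ∑ l ∈ range M, |pairKernelAt r i₀ j k l| ≤
      256 * M * (1 + Real.log M) ^ 2 :=
  (Finset.sum_le_sum fun j _ => Finset.sum_le_sum fun k _ => Finset.sum_le_sum fun l _ =>
    abs_pairKernelAt_le_prod r i₀ j k l).trans (slab_bound_sum_le M i₀ hi)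

/-- **Slab sum, third time fixed**: `Σ_{i,j,l<M} |pairKernelAt r i j k₀ l| ≤ 256 M (1 + log M)²`
for `k₀ < M`. [cite: Stoll1989, §1, Proposition 1.10] -/
theorem slab_sum_abs_pairKernelAt_le' (r M k₀ : ℕ) (hk : k₀ < M) :
    ∑ i ∈ range M, ∑ j ∈ range M, ∑ l ∈ range M, |pairKernelAt r i j k₀ l| ≤
      256 * M * (1 + Real.log M) ^ 2 := by
  calc _ ≤ ∑ i ∈ range M, ∑ j ∈ range M, ∑ l ∈ range M,
        32 / ((|((min k₀ l : ℕ) : ℝ) - (min i j : ℕ)| + 1) * (|((max k₀ l : ℕ) : ℝ) - (max i j : ℕ)| + 1)) := by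
        refine Finset.sum_le_sum fun i _ => Finset.sum_le_sum fun j _ => Finset.sum_le_sum fun l _ => ?_
        rw [abs_sub_comm (((min k₀ l : ℕ) : ℝ)), abs_sub_comm (((max k₀ l : ℕ) : ℝ))]
        exact abs_pairKernelAt_le_prod r i j k₀ l
    _ = ∑ i ∈ range M, ∑ l ∈ range M, ∑ j ∈ range M,
        32 / ((|((min k₀ l : ℕ) : ℝ) - (min i j : ℕ)| + 1) * (|((max k₀ l : ℕ) : ℝ) - (max i j : ℕ)| + 1)) :=
        Finset.sum_congr rfl fun i _ => Finset.sum_comm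
    _ = ∑ l ∈ range M, ∑ i ∈ range M, ∑ j ∈ range M,
        32 / ((|((min k₀ l : ℕ) : ℝ) - (min i j : ℕ)| + 1) * (|((max k₀ l : ℕ) : ℝ) - (max i j : ℕ)| + 1)) :=
        Finset.sum_comm
    _ ≤ _ := slab_bound_sum_le M k₀ hk


end Edwards2D

end Literature.Barriers.CriticalPhenomena
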